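import Mathlib
import HarnessLib
import HarnessLib.Audit
import Summits.QuantumFields.Statement
import Literature.MathematicalPhysics.QuantumFieldTheory.MultibosonAdmissibleData
import Literature.MathematicalPhysics.QuantumFieldTheory.Multiboson

/-!
Route: MultibosonBridge

DORMANT since 2026-09-04T23:02:17Z (reconciler: no traction for 5 d (last activity statement-checked at 2026-08-30T22:17:55Z); parked, not closed — `ledger route dormant route-QuantumFields-MultibosonBridge --off` to reactivate) — unstaffed, not closed; items shared with open routes are served there. `ledger route dormant <id> --off` reactivates.

# Route MultibosonBridge — Lüscher's multiboson identity as a constructive bridge — lattice QCD =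
exactly reweighted positive-weight SU(3) gauge–Higgs system; its gap transfers through a dilute
spectral tail

It suffices to show X = MultibosonLatticeGapR4 ∧ GapTransferR3 ∧ LatticeToContinuumC (card
QuantumFields/QCD/multiboson-gauge-higgs-bridge;
LatticeToContinuumC and its antecedent FullLatticeGapC are, since rev 7, the CHIRALLY PINNED forms
of the spine nodes LatticeToContinuum /
FullLatticeGap of DiagonalSpine that revs 1–6 re-asked verbatim — see REPAIR (rev 7); once the spine
files its own pinned nodes they are
re-asked verbatim in addition, so this route ATTACHES to them again). Mechanism: per flavour f let
H_f = γ₅ D_W(U, m_f(k)) (hermitian) and pick a finite list ν_f of NON-REAL roots with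
q_f(t) := κ_f ∏_(z∈ν_f) |t − z|² ≈ 1/|t| off a spectral gap |t| ≤ √ε_k·c (κ_f > 0 is Lüscher's
normalisation c_n, restored in rev 4). Then det D_f = det H_f = R_f · W_f⁻¹·… exactly:
W(U) := ∏_f ∏_z |det(H_f − z)|⁻² is a POSITIVE bounded weight, each factor being a convergent local
Gaussian boson integral
(MultibosonGaussian) — Wilson weight × W is an SU(3) lattice gauge–Higgs system with n_k = |ν|
scalar multiplets (Lüscher's multiboson
identity) — and the exact correction R = ∏_f det H_f · ∏_i q_f(λ_f,i) = ∏_f ∏_i λ_f,i q_f(λ_f,i) is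
real, ≤ (1+δ_k)^N always, equal to
(1 ± δ_k)^N off the spectral tail, so every honest lattice QCD expectation is E^bos[· R]/E^bos[R]
(ReweightingIdentity). MultibosonLatticeGapR4
(construction, rank 2): for N_f ∈ {2,3} one mass-independent regularisation (HasMassScaling,
two-loop asymptotic scaling, physical branch,
CHIRAL AT ZERO in the subsequence-stable form of rev 7) such that for every m > 0 ADMISSIBLE
multiboson data with tolerances TIED TO THE SPACING (δ_k = o(a_k²)) exist whose bosonised gauge
marginal has a
volume-uniform lattice gap Δ(m) > 0 and a DILUTE spectral tail. GapTransferR3 (rank 3): along every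
such regularisation scheme (N_f ∈ {2,3}, mass
scaling, asymptotic scaling, m > 0, physical branch), admissible tied data + dilute tail + bosonised
gap Δ ⇒ QCD's `HasLatticeMassGap Δ'` for some
Δ' ∈ (0, Δ]. Together they give FullLatticeGapC (the pinned lattice half); LatticeToContinuumC (the
continuum half) gives QCD. Since rev 6 the
items are stated in the landed Literature vocabulary (IsAdmissibleMultibosonDataR,
HasSpectralTailDomination, QCDScheme.HasMultibosonLatticeGap,
multibosonExpect — definitionally the rev-5 `let`s, Iff.rfl).
REPAIR (rev 4, 2026-08-15): MultibosonLatticeGap (refuted: the typed q was MONIC, and a monic |t|∏|t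
− z|² cannot stay below 2 on
[−c,c], c ≥ 4 — Theorems/MultibosonBridgeMultibosonLatticeGapRefutation) and AdmissibleRootsExist
(refuted: its ε-uniform Chebyshev-mass
certificate δ⁻⁸ contradicts the forced ((1−δ)/π)log(1/ε) growth —
Theorems/MultibosonBridgeAdmissibleRootsExistRefutation) stay in the
file as settled negatives; the repaired items carry the normalisation κ_{k,f} > 0 and replace the
certificate by the degree bound
|ν_{k,f}| ≤ ℓ_k·log(2/δ_k) (H q(H) has STRICT range ≤ 2ℓ_k log(2/δ_k) + 1 hops).
RECALIBRATION (rev 5, 2026-08-15): Adm's bounded PHYSICAL range ∃ρ ∀k a_k ℓ_k ≤ ρ became the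
scale-free ∃ρ ∀k √ε_k ℓ_k ≤ ρ (the filter must
resolve the BARE spectral gap a_k m_q(k) → 0·a_k of |γ₅D_W(m_f(k))|, so boxes grow like Z_m(k)/m in
physical units; with a_k ℓ_k ≤ ρ only
decoupling witnesses met Adm ∧ Tail); rev-4 items MultibosonLatticeGapR / GapTransferR retired, not
refuted.
REPAIR (rev 6, 2026-08-15): GapTransferR2 was diagnosed refuted-misstated at the PHYSICS level by a
refuter crux-attack (stmt-11127 notes +
evidence crux_attack_GapTransferR2.md, GapTransferR2_repaired.lean; no ¬-theorem): over RAW schemes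
(chiral trajectories m_cr(β_k) + a_k²u included)
and tolerances δ_k → 0 at a FREE rate, the exact correction R = exp(Σ_f tr log(1 +
r̃_f(H_f)))·(defects), |r̃| ≤ δ_k of selectable shape, is an
extensive quasi-local action of strength δ_k per site that shifts the bosonised theory's critical
mass by ≍ δ_k/β_k² ≫ a_k², so μ^bos can be
massive and gapped (Tail plausible under this route's own dislocation bet) while signed QCD at the
same bare parameters is chiral and gapless.
Both R2 items are retired (not refuted) for R3 items with ONE new conjunct, the RATE TIE δ_k/a_k² →
0 (every induced shift of bare parameters
vanishes in physical units even against a_k²u, so μ^bos is chiral exactly when QCD is and the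
transfer is vacuous there; free for the ∃-data:
δ_k = a_k³), and with the transfer stated along the schemes reg.scheme m 0 0 (HasMassScaling,
asymptotic scaling, m > 0, physical branch,
N_f ∈ {2,3}) that `closes` actually instantiates. A standing CAVEAT from the crux-attack on the
rank-2 item (a tenure matter shared with
FullLatticeGap and the Statement's unpinned offset, not a misstatement): reg.mcrit is free, and
D_W(m) − t is coercive for every bare m > 0,
t ≤ 0, so parked (cutoff-heavy) witnesses empty Tail; the light-quark mechanism is forced only
downstream, by LatticeToContinuum — RESOLVED in rev 7.
REPAIR (rev 7, 2026-08-16; Statement re-type p117723: `def QCDOf` gained the conjunct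
`reg.IsChiralAtZero` — for every ε > 0 some positive
mass tuple has no uniform lattice gap ε, which pins the additive offset M₀ hidden in m_crit to the
chiral point): the pin is supplied by THIS
route's construction, as the KILL CRITERIA foresaw ("a spine-level pin of mcrit … is mirrored here
by a restate of the rank-2 item").
MultibosonLatticeGapR3 is retired (not refuted) for MultibosonLatticeGapR4 = R3 ∧ ONE new conjunct
on reg, chirality at zero in
SUBSEQUENCE-STABLE form: ∀ ε > 0 ∃ m > 0 ∃ lattice observables A, B ∀ C ∀ᶠ k ∃ S ≥ L_k ∃ n ≤ S,
C·e^(−ε a_k n) < ‖⟨A·τ_n B⟩^conn_(k,2S+1)‖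
(eventually in k the ε-rate bound fails at every constant — physically 'the flavour-changing pion is
lighter than ε in physical units on
every fine lattice', m_π² ∝ m: GasserLeutwyler1984; Wilson lattice: Aoki1984WilsonPhase,
SharpeSingleton1998; S is free, so no operator
normalisation enters). It implies `reg.IsChiralAtZero` (planner Sketch.lean
`strong_imp_isChiralAtZero`, rc 0) and — unlike the plain
conjunct, whose negated `∀ᶠ k` is only `∃ᶠ k` and is NOT preserved along subsequences (witness:
mcrit honest at even k, parked at odd k) —
it survives the passage to the diagonal subsequence every continuum half makes (support
StableChiralityTransfers, proved in the Sketch).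
In THIS route the spine nodes are replaced by FullLatticeGapC (FullLatticeGap ∧ the same clause) and
LatticeToContinuumC := FullLatticeGapC →
QCD (FullLatticeGap, LatticeToContinuum dropped here, kept by the spine); GapTransferR3 is unchanged
(the transfer acts at fixed m > 0). The
rev-5/6 CAVEAT is thereby resolved: a parked (cutoff-heavy) witness no longer meets the rank-2 item,
whose Tail clause must now hold at
light bare masses a_k m/Z_m(k) → 0 above the honest critical line.
Lean: `MultibosonLatticeGapR4 ∧ GapTransferR3 ∧ LatticeToContinuumC`

## Assembly
Pure logic — the deciding theorem `closes : MultibosonLatticeGapR4 → GapTransferR3 →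
LatticeToContinuumC → QCD` (planner's Sketch.lean
rev 7, rc 0, axioms propext/choice/Quot.sound): apply LatticeToContinuumC; for N_f ∈ {2,3}
MultibosonLatticeGapR4 gives reg (HasMassScaling,
asymptotic scaling, the subsequence-stable chiral clause) and for m > 0 the physical branch and data
(ε, δ, p, ℓ, κ, ν) with admissibility,
the rate tie, Tail, Δ > 0, Gap Δ; GapTransferR3 at (N_f, reg, m, data, Δ) with exactly these
hypotheses gives Δ' > 0 with
(reg.scheme m 0 0).HasLatticeMassGap Δ'; with the chiral clause passed on verbatim this is
FullLatticeGapC. Both items use the same landed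
predicates at sch := reg.scheme m 0 0, so hypotheses match syntactically; `reg.IsChiralAtZero`
itself is produced inside LatticeToContinuumC
from the strong clause (StableChiralityTransfers with φ = id).

Rationale: WHY THIS LINE. Lüscher's identity (Luscher1994; error analysis BoriciDeforcrand1995; odd-power /
one-flavour variants BorrelliDeforcrandGalli1996, FrezzottiJansen1997) is exact
finite-dimensional algebra and has only ever been a simulation device; read constructively it puts
massive N_f-flavour lattice QCD, up to ONE explicit real reweighting factor R,
inside the positive-weight gauge–Higgs class — the best-understood corner of constructive gauge
theory (OsterwalderSeiler1978, Balaban1988Convergent; BalabanOcarrollSchor1989 is the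
Grassmann-side technology it bypasses) and the only one where probabilistic tools (couplings,
convexity, Markov dynamics, chessboard estimates) are available for the LATTICE GAP,
the node every QCD route opened so far leaves as a black box. The new analytic demands are isolated
and typed: admissibility of the root lists is two-interval approximation
with a gap (AdmissibleRootsExistR; strict finite range of H q(H), cf. BenziGolub1999), and the whole
sign / near-zero-mode problem of Wilson quarks becomes the statement that
localised spectral defects of D_W at the PHYSICAL-side bare mass form a p_k-dilute gas under the
bosonised measure, for which quenched evidence exists (EdwardsHellerNarayanan1999:
gap of γ₅D_W below m₁, ρ(0;m) → 0 faster than any power of a; DebbioEtAl2006). Imported areas: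
numerical-lattice bosonisation, approximation theory, polymer/cluster perturbation
of Gibbs measures (KoteckyPreiss1986, DobrushinShlosman1987). The two negatives of this route (rev
3: monic obstruction; ε-uniform Chebyshev-mass certificate) are avoided by
construction since rev 4 (κ_{k,f} > 0; a degree bound), the physics-level detuning scenario against
the rev-5 transfer is answered since rev 6 by the rate tie δ_k = o(a_k²), and
since rev 7 (Statement re-type 2026-08-16) the chiral pin `IsChiralAtZero` is carried by the
construction item in subsequence-stable form (§ Thesis, REPAIR rev 7) — it costs the
line nothing it did not already owe (the light-quark regime has been the intended witness since rev
5) and removes the parked-witness degeneracy refuters recorded on R2/R3; no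
other QCD route uses a bosonic auxiliary measure.

RANKED CRUXES. #0 Thesis (target) — X = MultibosonLatticeGapR4 ∧ GapTransferR3 ∧ LatticeToContinuumC
as in § Thesis. (why it might fail: the bosonised (sign-blind, polynomially filtered) lattice theory
may be exactly as hard as QCD's own lattice gap, and transfer may need a full cluster structure
rather than covariance decay.) [Luscher1994, OsterwalderSeiler1978, EdwardsHellerNarayanan1999,
JaffeWitten2000]
#2 MultibosonLatticeGapR4 (crux; repaired MultibosonLatticeGap rev 4, recalibrated rev 5, named
vocabulary + rate tie rev 6, chiral pin rev 7) — (card K3 + K2-DOS; THE CONSTRUCTION) for N_f = 2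
and N_f = 3 there is reg : QCDRegularisation N_f with HasMassScaling, (reg.scheme 0 0
0).HasAsymptoticScaling, the SUBSEQUENCE-STABLE CHIRAL CLAUSE (rev 7: ∀ ε > 0 ∃ m > 0 ∃ R R' (A :
QCDLatticeObservable N_f R) (B : QCDLatticeObservable N_f R') ∀ C ∀ᶠ k ∃ S ≥ L_k ∃ n ≤ S, C·exp(−ε
a_k n) < ‖qcdLatticeConnectedCorr β_k (2S+1) m(k) A B n‖ — it implies reg.IsChiralAtZero and passes
to subsequences) and, for every mass tuple m > 0, the physical branch m_f(k) > −1 eventually and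
multiboson data (ε_k, δ_k, p_k, ℓ_k, κ_{k,f} > 0, non-real root lists ν_{k,f}) with, for sch :=
reg.scheme m 0 0: IsAdmissibleMultibosonDataR sch ε δ ℓ κ ν (rev-5 shape: √ε_k ℓ_k ≤ ρ, δ_k → 0, ε_k
ℓ_k² ≥ 64, |ν_{k,f}| ≤ ℓ_k log(2/δ_k), |t|·κ_{k,f}∏|t − z|² = 1 ± δ_k off the gap, ≤ 1+δ_k on it) ∧
δ_k/a_k² → 0 (rate tie; free: δ_k = a_k³) ∧ HasSpectralTailDomination sch ε p ℓ ν (box-supported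
real quasi-modes t ≤ 0 of some D_W(m_f(k)) at level 2√ε_k c are p_k-rare under the bosonised
measure) ∧ ∃ Δ > 0, sch.HasMultibosonLatticeGap ν Δ (volume-uniform covariance decay under E^bos =
multibosonExpect, weight W = ∏_f ∏_z |det(γ₅D_W(m_f(k)) − z)|⁻²). Intended witness: band edge √ε_k c
≈ a_k m_q(k)/2.2, ℓ_k = ⌈8/√ε_k⌉, δ_k = a_k³, mcrit(k) on the Wilson chiral critical line; per-(k,f)
satisfiability of the admissibility clauses is AdmissibleRootsExistR. The rev-5/6 CAVEAT (mcrit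
free, D_W(m) − t coercive for bare m > 0, so a parked witness mcrit ≡ 1 emptied Tail) is RESOLVED by
the pin: a parked regularisation keeps a glueball-size lattice gap at every m > 0 and violates the
chiral clause, so the witness sits on the honest critical line with light bare masses a_k m/Z_m(k) →
0, where Tail is the route's dislocation-rarity bet. [difficulty: open-problem] (why it might fail:
the uniform gap of sign-blind, polynomially filtered massive lattice QCD is Yang–Mills-hard
(PerturbativeInvisibility), with the bosonic multiscale analysis needed uniformly in n_k ≍
log(1/a_k)/√ε_k → ∞ multiplets; Tail needs dislocation zero-modes super-rare in boxes GROWING like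
Z_m(k) in physical units at LIGHT bare masses (quenched numerics only); the chiral clause adds the
Wilson chiral transition — an Aoki finger or a first-order jump of physical width across the light
trajectories falsifies it.) [Luscher1994, BoriciDeforcrand1995, Balaban1988Convergent,
OsterwalderSeilerAnnPhys1978, SeilerLNP1982, EdwardsHellerNarayanan1999, DebbioEtAl2006,
MontvayMunster1994, JaffeWitten2000, SharpeSingleton1998, Aoki1984WilsonPhase, GasserLeutwyler1984]
RETIRED, not refuted: rev 4 → 5 MultibosonLatticeGapR / GapTransferR (range clause a_k ℓ_k ≤ ρ
excluded every light-quark witness); rev 5 → 6 MultibosonLatticeGapR2 / GapTransferR2 (GapTransferR2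
diagnosed refuted-misstated at the physics level, crux-attack on stmt-11127: raw schemes + free δ_k
rate; R3 = landed vocabulary + rate tie δ_k/a_k² → 0 + transfer along reg.scheme m 0 0 only); rev 6
→ 7 MultibosonLatticeGapR3 (Statement re-type p117723: + the subsequence-stable chiral clause;
GapTransferR3 kept). DROPPED here in rev 7 (still DiagonalSpine's nodes, not refuted):
FullLatticeGap and LatticeToContinuum := FullLatticeGap → QCD — after the re-type the latter asks
its prover to produce `IsChiralAtZero` from a possibly parked gapped regularisation; replaced by the
pinned pair FullLatticeGapC / LatticeToContinuumC.
REFUTED, kept as settled negatives (rev 3): MultibosonLatticeGap (¬ by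
Theorems/MultibosonBridgeMultibosonLatticeGapRefutation: the monic q forces a monic polynomial of
degree 2|ν|+1 below 1+δ < 2 on [−c,c], c ≥ 4 — impossible) and AdmissibleRootsExist (¬ by
Theorems/MultibosonBridgeAdmissibleRootsExistRefutation: Σ|b_j| ≥ ((1−δ)/π)log(1/ε) − O(1) against
the ε-uniform δ⁻⁸); GapTransfer (rev 3) was vacuous by the same monic obstruction.
#3 GapTransferR3 (crux; rev 6 item, unchanged in rev 7 — the transfer acts at fixed m > 0) — (card
K2, made a theorem) for N_f ∈ {2,3}, EVERY reg : QCDRegularisation N_f with HasMassScaling and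
two-loop asymptotic scaling, every m > 0 eventually on the physical branch, data (ε, δ, p, ℓ, κ, ν)
and Δ > 0, with sch := reg.scheme m 0 0: IsAdmissibleMultibosonDataR sch ε δ ℓ κ ν → δ_k/a_k² → 0 →
HasSpectralTailDomination sch ε p ℓ ν → sch.HasMultibosonLatticeGap ν Δ → ∃ Δ' ∈ (0, Δ] with
sch.HasLatticeMassGap Δ' — QCD's full lattice gap (signed determinant; ALL gauge-invariant local
lattice observables), uniformly in the volume. The rate tie δ_k = o(a_k²) makes the bulk of R =
exp(Σ_f tr log(1 + r̃_f(H_f)))·(defects) IR-irrelevant, and the scheme restriction is the instance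
closes uses. Mechanism: expand R — a δ_k-small STRICTLY local bulk (H q(H) is a polynomial of degree
≤ 2ℓ_k log(2/δ_k)+1 in H = γ₅D_W, physical range ≍ log(1/a_k)/m_q(k), GROWING) times a dilute
REPULSIVE defect gas from Tail — around μ^bos, Wick-contracting the quarks with the polynomial
propagators q_f(H_f)² H_f γ₅. [difficulty: XL] (why it might fail: log R is extensive and its range
grows like log(1/a_k)·Z_m(k)/m in physical units, so a cluster expansion alone gives Δ'_k ≲ 1/range
→ 0 and a UNIFORM Δ' needs a multiscale transfer; Tail is diluteness under μ^bos only; weak ⇏ strong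
mixing in d > 2 (Martinelli1999 §2.3); sign of E^bos[R] at N_f = 3.) [KoteckyPreiss1986,
DobrushinShlosman1987, Martinelli1999, SeilerLNP1982, BenziGolub1999, Luscher1994,
MohlerSchaefer2020, MontvayMunster1994, SharpeSingleton1998]
#4 FullLatticeGapC (crux; rev 7) — THE PINNED LATTICE HALF: DiagonalSpine.FullLatticeGap ∧ the
subsequence-stable chiral clause (inserted after HasAsymptoticScaling, byte-identical with
MultibosonLatticeGapR4's); here the OUTPUT of MultibosonLatticeGapR4 + GapTransferR3 by pure logic,
filed as a crux so the spine and other routes can attach: for N_f = 2, 3 one mass-independent reg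
with HasMassScaling, two-loop asymptotic scaling and the chiral clause such that for every positive
mass tuple the bare masses are eventually on the physical branch and signed-determinant lattice QCD
has a uniform lattice gap `HasLatticeMassGap Δ(m)`. [deps: MultibosonLatticeGapR4, GapTransferR3]
[difficulty: open-problem] (why it might fail: the SU(3) Yang–Mills lattice gap plus the
Wilson-fermion infrared at negative bare mass, now on the HONEST critical line: false if an Aoki
finger or a first-order jump of physical width crosses every light positive-mass trajectory, or if
the minimal Wilson pion mass does not vanish with a.) [JaffeWitten2000, OsterwalderSeiler1978,
Luscher1977, MontvayMunster1994, SharpeSingleton1998, Aoki1984WilsonPhase, FarchioniEtAl2005]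
#5 LatticeToContinuumC (crux; rev 7) — THE CONTINUUM HALF over the pinned lattice half,
FullLatticeGapC → QCD: from the gapped, chirally pinned reg pass to one diagonal subsequence serving
all masses (every clause of reg is a tail property and survives — the chiral clause by
StableChiralityTransfers, which also yields the Statement's `IsChiralAtZero`), calibrate species
renormalisations, get convergence (tightness + mass-equicontinuity from the gap), OS axioms E0'–E4
(E1 restored), IsQCDAlong, T.HasMassGap and the non-triviality / dynamical-quark clauses. This route
adds nothing to the spine's proof except that, through ReweightingIdentity, the bosonised marginal
offers positive-measure tools for the tightness estimates. [deps: FullLatticeGapC] [difficulty: XL]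
(why it might fail: E1 (rotations) for a subsequential 4D lattice limit has no non-perturbative
proof; calibrated tightness = fermionic UV stability, unproved; per-pair gap constants carry no
m-uniformity, so equicontinuity may fail at contact terms.) [OsterwalderSchrader1975,
OsterwalderSeiler1978, GlimmJaffeQP1987, Luscher1977, MontvayMunster1994]
#9 StableChiralityTransfers (support; rev 7) — for reg, reg' : QCDRegularisation N_f and a strictly
increasing φ with reg'.(a, β, L, mcrit, Zm) = reg.(a, β, L, mcrit, Zm) ∘ φ: the chiral clause of reg
implies that of reg' AND reg'.IsChiralAtZero (φ = id: Strong ⟹ the Statement's conjunct). PROVED in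
the planner's Sketch.lean (attached). [difficulty: provable-now] [MontvayMunster1994]
#9 ReweightingIdentity (support) — the exact bridge: for non-real root lists every lattice QCD torus
expectation `qcdTorusExpect β S m X` equals E^bos[FI(X·e^(−ψ̄Dψ))/W] / E^bos[FI(e^(−ψ̄Dψ))/W] (W > 0
pointwise and bounded; pointwise identity). [difficulty: provable-now] [Luscher1994,
MontvayMunster1994]
#9 MultibosonGaussian (support) — the dictionary "one root = one local boson field": for non-real z,
∫_(ℂ^N) exp(−‖(γ₅D_W(U,μ) − z)v‖²) dv = π^N / |det(γ₅D_W(U,μ) − z)|², so each factor of W is a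
convergent Gaussian integral with positive, gauge-covariant, next-nearest-neighbour quadratic action
and the bosonised theory IS a lattice SU(3) gauge–Higgs system. [difficulty: provable-now]
[Luscher1994, GlimmJaffe1987]
#9 AdmissibleRootsExistR (support; repaired AdmissibleRootsExist, rev 4; refuter-checked numerically
in 7 regimes) — two-interval approximation with a gap in the normalised form the cruxes use: for 0 <
ε < 1, 0 < δ < 1, c > 0 and ℓ ∈ ℕ with ε ℓ² ≥ 64 there are κ > 0 and ≤ ℓ·log(2/δ) NON-REAL roots
with |t|·κ∏|t − z|² ∈ [1−δ, 1+δ] for √ε c ≤ |t| ≤ c and ≤ 1+δ for |t| ≤ √ε c. Construction: s =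
(t/c)², interpolate the Stieltjes function (s + δε)^(−1/2) at the m+1 Chebyshev nodes of [ε,1], m
EVEN, m+1 ≥ log(4/δ)/(2√ε): relative error ≤ 2((1−√ε)/(1+√ε))^(m+1) ≤ δ/2 on [ε,1] (Luscher1994 §4
(4.18)–(4.19)), 0 < P < g on [0,ε) and P > 0 on [1,∞), so q(x) := P(x²) has only non-real roots.
[difficulty: M] [Luscher1994, FrezzottiJansen1997, BorrelliDeforcrandGalli1996, BenziGolub1999]

TWO-LAYER PLAN. MultibosonLatticeGapR4 ⇐ BosonicUniformGap (Gap Δ for the gauge–Higgs-class measure: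
n-uniform multiscale analysis — Bałaban block RG for U with EXACT Gaussian integration of the
multiplets — or positive-measure IR tools) → SpectralTailRarity (Tail: Wegner/dislocation estimate
under μ^bos) → ChiralWindow (rev 7, the pin: a GMOR/Aoki-type LOWER bound on the flavour-changing
pseudoscalar correlator of signed lattice QCD at light bare masses above the honest critical line,
eventually in k, S free) → MultibosonLatticeGapR4 (AdmissibleData = AdmissibleRootsExistR along the
scheme, δ_k = a_k³, rides as support). GapTransferR3 ⇐ BulkReweighting (o(a_k²)-small strictly local
factor, IR-irrelevant by the rate tie) → DefectGasReweighting (p_k-dilute repulsive gas) →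
GapTransferR3. The own-volume transfer of CONVERGENCE (informal item 9787 LimitTransfer) can be
re-filed over the landed vocabulary as a support of LatticeToContinuumC (tenure).

KILL CRITERIA. Close `refuted:MultibosonLatticeGapR4` if Tail is shown impossible along every
asymptotically scaling Wilson-action family — a theorem (or decisive EHN-type numerics at the
physical-side mass, W-reweighted) that localised real/near-zero modes of D_W keep a non-vanishing
density per PHYSICAL 4-volume — or if Adm ∧ Gap is shown incompatible (the filtered theory gapless
wherever it is admissible). A counterexample to GapTransferR3 (a tied family along a massive
regularisation scheme meeting Adm+Tail+Gap with gapless signed QCD) forces a PIVOT — restate Gap as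
a strong-mixing / polymer-representation hypothesis — not a close; a further physics-level detuning
of its hypotheses from the scheme is restated only with a written dictionary 'clause ↦ physical
scale'; the next is a pivot. ¬AdmissibleRootsExistR (constants 64, log(2/δ), 1+δ) ⇒ restate
constants, not load-bearing; a refutation of an R4/C item by a DEGENERACY of the vocabulary or of
the chiral clause's typing (junk value of qcdTorusExpect, quantifier order, boundary conditions) ⇒
restate ONCE with the refuter's repaired clause. ¬FullLatticeGapC by PHYSICS — a theorem that the
chiral clause is incompatible with `∀ m > 0 ∃ Δ > 0 HasLatticeMassGap Δ` under mass scaling +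
asymptotic scaling (e.g. a chiral transition of physical width forced on every asymptotically
scaling Wilson family) — closes this route together with every pinned spine. If the
uniformity-vs-resolution tension (GapTransferR3 why-line) is judged fatal, the honest outcome is a
tenure PIVOT (filter at a fixed physical scale + a chiral IR crux). FullLatticeGapC, or any pinned
lattice half implying it, proved by another route moots cruxes 2–3. If DiagonalSpine files pinned
nodes with a different chiral clause, tenure re-asks them verbatim IN ADDITION (Strong ⟹ plain keeps
closes composable), never instead. (Rev 7 executed the rule recorded here since rev 5: a pin of
mcrit is mirrored by a restate of the rank-2 item in the same revision.)

NOT DECOMPOSED YET. The bosonic-side multiscale analysis (no gauge–Higgs block-RG vocabulary in the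
tree), the Wegner/dislocation estimate behind Tail, the polynomial-propagator locality lemma and the
own-volume LimitTransfer, the IR-irrelevance lemma behind the rate tie, the ChiralWindow child
behind the rev-7 pin (lower bound on the pion correlator at light Wilson masses — Aoki-phase / GMOR
physics, no expansion converges there), and all constants — layer-2 children or restates after the
first stamp of the R4/C items; reflection positivity of the bosonised system is not needed (RP is
used QCD-side inside LatticeToContinuumC).

CHEAPEST FALSIFIER. Dislocation arithmetic + one lookup: under μ^bos the density of spectral defects
per physical 4-volume scales like a^((11−2N_f/3)·x_min − 4 + N_f) (x_min = minimal Wilson action, in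
instanton units, of an SU(3) lattice field binding a real D_W-mode crossing at the physical-side
bare mass; a^(N_f) is the |det|-type suppression of a near-zero mode by W). The line needs x_min >
2/9.67 ≈ 0.21 (N_f = 2) and > 1/9 ≈ 0.11 (N_f = 3), against the quenched geometric-charge threshold
4/11 ≈ 0.36 below which PughTeper1989 and GockelerEtAl1989 found Wilson-action dislocations;
EdwardsHellerNarayanan1999 report a spectral gap of γ₅D_W below m₁ and ρ(0;m) → 0 faster than any
power of a (quenched), which is favourable. A kit minimisation of the Wilson action over 2⁴–3⁴ SU(3)
configurations supporting a real D_W-mode crossing at the physical-side mass settles x_min. Second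
check, Lean-level: AdmissibleRootsExistR is provable now. Third check (rev-5 calibration): free
Wilson–Dirac arithmetic for the lowest box modes and the bulk edge of |γ₅D_W| relative to a m_q on
quenched configurations (DebbioEtAl2006, GiustiLuscher2009). Fourth check (rev-7 pin): Lean-level —
`strong_imp_isChiralAtZero` and `stableChiralityTransfers_holds` are PROVED in the planner's
Sketch.lean (rc 0, std axioms; attached); physics-level — dynamical Wilson N_f = 2 phase-structure
data near κ_c (FarchioniEtAl2004: first order at a ≈ 0.16 fm with a minimal pion mass;
FarchioniEtAl2005: its strength SHRINKS with a; EdwardsHellerNarayanan1998: Aoki phase) are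
consistent with 'eventually in k'; a minimal Wilson pion mass NOT vanishing with a would kill the
pin — and the Statement's conjunct for every Wilson regularisation.

NUMBERS. b₀(N_f) = (11 − 2N_f/3)/(16π²) (tree `betaCoeff₀`); Lüscher's Chebyshev construction for
1/s on [ε,1]: relative error δ = 2((1−√ε)/(1+√ε))^(n+1), n ≈ log(2/δ)/(2√ε) roots; locality scale
ℓ_k = 8 ε_k^(−1/2) ≈ 16c Z_m(k)/(a_k m) lattice units (Z_m(k) ≍ (log a_k⁻²)^(γ₀/2β₀), γ₀/2β₀ =
12/(33−2N_f)); rate tie δ_k = a_k³ ⇒ |ν_{k,f}| ≈ 3.3c log(1/a_k) Z_m(k)/(a_k m) multiplets per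
flavour; bulk factor (1 ± a_k³)^N, N = 12 N_f (2S+1)⁴, o(a_k²) per site; one-loop critical mass a
m_cr = −0.434 g₀² (SU(3), r = 1; MontvayMunster1994 §5.1); quenched dislocation threshold s_* =
16π²/33 ≈ 4.79 plaquette units vs s_inst = 4π²/3 ≈ 13.2. GMOR scale of the pin: m_π² ≈ 2Bm, B =
|⟨ψ̄ψ⟩|/f_π² ≈ (0.27 GeV)³/(0.092 GeV)² ≈ 2.3 GeV, so the witness mass for gap-failure rate ε is
m(ε) ≈ ε²/(4.7 GeV) (ε = 140 MeV ↦ m ≈ 4 MeV; GasserLeutwyler1984). Items after rev 7: 4 live cruxes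
(MultibosonLatticeGapR4 r2, GapTransferR3 r3, FullLatticeGapC r4, LatticeToContinuumC r5), supports
ReweightingIdentity, MultibosonGaussian, AdmissibleRootsExistR, StableChiralityTransfers,
LimitTransfer (informal), the Assembly; retired R, R2 (rev 4/5), R3 (rev 7); dropped here, kept by
the spine: FullLatticeGap, LatticeToContinuum; settled negatives MultibosonLatticeGap,
AdmissibleRootsExist.

DEFINITION REQUESTS. LANDED (Literature/MathematicalPhysics/QuantumFieldTheory): Multiboson.lean —
`multibosonWeight`, `multibosonExpect`, `multibosonModSq`, `HasSupportedQuasiMode`,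
`HasSpectralTailDomination`, `QCDScheme.HasMultibosonLatticeGap`, the refuted rev-3
`IsAdmissibleMultibosonData`; MultibosonAdmissibleData.lean — `IsAdmissibleMultibosonDataR`. Still
wanted, for LimitTransfer / PolynomialPropagatorLocality: `multibosonPropagator`,
`QCDScheme.multibosonSchwinger`, `IsMultibosonAlong`; optional (rev 7):
`QCDRegularisation.IsStablyChiralAtZero` naming the subsequence-stable chiral clause (inlined three
times). Bib keys of this route: Luscher1994, BoriciDeforcrand1995, FrezzottiJansen1997,
BorrelliDeforcrandGalli1996, EdwardsHellerNarayanan1999, BenziGolub1999; rev 7 adds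
Aoki1984WilsonPhase, GasserLeutwyler1984, FarchioniEtAl2004, FarchioniEtAl2005,
EdwardsHellerNarayanan1998.

Novelty: Searches (2026-08-15): `lit search --source crossref "Luscher multiboson algorithm local bosonic
theory dynamical quarks"` (8: all algorithmic —
BorrelliDeforcrandGalli1996, Peardon 1995, Galli–de Forcrand 1997, Duncan–Eichten–Thacker 1998);
`lit search --source crossref "bosonized fermion
determinant rigorous bound gauge theory continuum limit sign quenched Wilson fermions"` (8: nothing
constructive); `lit search --source crossref`
for DebbioEtAl2006, FrezzottiJansen1997, PughTeper1989, GockelerEtAl1989, BenziGolub1999,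
EdwardsHellerNarayanan1999 (all found; EHN 1999 read,
pp. 4–8); `lit galaxy search "multiboson" --star all` (20 rows: Gattringer–Lang, DeGrand–DeTar,
Montvay SYM review, Frezzotti–Jansen PHMC —
textbook/algorithmic only); openalex budget exhausted, local searchd unavailable (rc 75); the six
QCD Theses opened today were read (none uses a
bosonic auxiliary measure; DiagonalSpine supplies the nodes this route attaches to); the card's own
searches (crossref ×6, hybrid ×1) and its
refuter audit cover the constructive side (OsterwalderSeiler1978, BIJ 1988, Balaban1988Convergent
never applied to a bosonised determinant).
Nearest prior art found: Luscher1994 (doi:10.1016/0550-3213(94)90533-9),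
BorrelliDeforcrandGalli1996, FrezzottiJansen1997 (exact local
bosonisation incl. odd flavours — simulation devices with stochastic correction of R); constructive
fermions stay Grassmann-side
(BalabanOcarrollSchor1989, Dimock2022QED3); EdwardsHellerNarayanan1999 / DebbioEtAl2006  [refs: 10.1016/0550-3213(94, doi:10.1016/0550-3213, BorrelliDeforcrandGalli1996, DebbioEtAl2006, FrezzottiJansen1997, PughTeper1989, GockelerEtAl1989, BenziGolub1999, EdwardsHellerNarayanan1999, OsterwalderSeiler1978, Luscher1994, BalabanOcarrollSchor1989]

Barriers (technique_class: multiboson-bosonisation, reweighting-transfer, gauge-higgs): - technique_class: multiboson-bosonisation, reweighting-transfer, gauge-higgs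
- Literature.Barriers.QuantumFields.WilsonDeterminantSign: applies head-on (positive auxiliary
measure; odd N_f = 3 and non-degenerate pairs) and is NOT evaded by dropping the sign: QCD = E^bos[·
R]/E^bos[R] is exact (ReweightingIdentity) and sign R = ∏_f sign det D_W(m_f); the bet, explicit in
Tail (real quasi-eigenvalues t ≤ 0 of D_W(m_f(k)) at FIXED physical m > 0, eventually in k), is that
sign defects are a dilute localised gas — rarity, not absence, in exactly the supercritical-κ regime
the barrier names.
- Literature.Barriers.QuantumFields.BanksCasherCriterion: no uniformly invertible propagator is used
— the quark propagators of the transfer proof are bounded polynomials q(H)²Hγ₅ and D_W⁻¹ only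
appears as adj(D_W) inside w·R; the near-zero tail is kept and controlled on average (Tail); masses
positive, no chiral limit.
- Literature.Barriers.QuantumFields.AokiPhaseDichotomy: m_crit(k) is witness data, never treated as
a chirally symmetric point; all clauses are "eventually in k at fixed m > 0", outside the O(a³)-wide
Aoki region; conceded that a first-order scenario makes the witness's fine-tuning delicate (inside
MultibosonLatticeGap).
- Literature.Barriers.QuantumFields.PerturbativeInvisibility: conceded for crux 2 — the bosonic-side
gap is asserted, not derived from the RG or weak coupling; GapTransfer is a non-perturbative polymer
statement.
- Literature.Barriers.QuantumFields.FixedCoupli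

History (route lifecycle, newest last):
- 2026-08-15T16:21:24Z · REPAIRED (restate MultibosonLatticeGap, GapTransfer, AdmissibleRootsExist, Assembly) — back to open: repair (rev 4): MultibosonLatticeGap refuted-misstated by Summit.QuantumFields.QCD.Theorems.MultibosonBridgeMultibosonLatticeGap_refuted (the typed q was MONIC (planner-rrefute-QuantumFields-MultibosonBridge-0aa0ba23-g4-0)
- 2026-08-15T16:49:54Z · rev 5: restated MultibosonLatticeGapR (stmt-QuantumFields-10697), GapTransferR (stmt-QuantumFields-10698), Assembly (stmt-QuantumFields-10700) — recalibration (rev 5): MultibosonLatticeGapR/GapTransferR (rev-4 repair of the refuted MultibosonLatticeGap, stmt-9599; that repair is kept: κ>0 + degree bound) (planner-rrefute-QuantumFields-MultibosonBridge-a9370450-g5-0)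
- 2026-08-15T17:50:37Z · rev 6: restated MultibosonLatticeGapR2 (stmt-QuantumFields-11126), GapTransferR2 (stmt-QuantumFields-11127), Assembly (stmt-QuantumFields-11128) — repair (rev 6): GapTransferR2 (stmt-11127) diagnosed refuted-misstated at PHYSICS level by refuter crux-attack (raw schemes + free δ_k rate ⇒ bosonised theory a (planner-rrefute-QuantumFields-MultibosonBridge-a9370450-g7-0)
- 2026-08-16T23:23:54Z · rev 7: restated MultibosonLatticeGapR3 (stmt-QuantumFields-11438), Assembly (stmt-QuantumFields-11440) — route-repair (statement-revised p117723: def QCDOf gained reg.IsChiralAtZero). Pin supplied by the construction: MultibosonLatticeGapR3 → R4 = R3 ∧ subsequence- (planner-rrepair-QuantumFields-MultibosonBridge-04420b5f-0)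
- 2026-08-16T23:23:54Z · rev 7: dropped stmt-QuantumFields-8928, stmt-QuantumFields-8929 — route-repair (statement-revised p117723: def QCDOf gained reg.IsChiralAtZero). Pin supplied by the construction: MultibosonLatticeGapR3 → R4 = R3 ∧ subsequence- (planner-rrepair-QuantumFields-MultibosonBridge-04420b5f-0)
- 2026-08-24T02:28:48Z · DORMANT — reconciler: no traction for 6.4 d (last activity item-evidence-added at 2026-08-17T14:57:38Z); parked, not closed — `ledger route dormant route-QuantumFields-Mu (operator:999:1561326)
- 2026-08-28T21:21:32Z · REACTIVATED — reconciler: reactivated — activity item-proof-filed at 2026-08-28T18:41:58Z after parking at 2026-08-24T02:28:48Z (operator:999:2834136)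
- 2026-09-04T23:02:17Z · DORMANT — reconciler: no traction for 5 d (last activity statement-checked at 2026-08-30T22:17:55Z); parked, not closed — `ledger route dormant route-QuantumFields-Multib (operator:999:2099347)

sub-problem: QCD · status: dormant · opened planner-plancard-QuantumFields-QCD-multiboson-16eaf030-0 2026-08-15T14:04:45Z · rev 7 · ledger route-QuantumFields-MultibosonBridge
GENERATED by the gate from the ledger (D-0016/17). Provers cite these decls: `theorem foo : Summit.QuantumFields.QCD.Theses.MultibosonBridge.<Decl> := …` in Summits/QuantumFields/QCD/Theorems/<Name>.lean.
-/

namespace Summit.QuantumFields.QCD.Theses.MultibosonBridge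

open scoped BigOperators Topology Manifold Classical MeasureTheory ProbabilityTheory Matrix InnerProductSpace ComplexConjugate ContinuousMap
open Filter Set Function TopologicalSpace MeasureTheory

attribute [summit_statement] _root_.QCD

/-- item stmt-QuantumFields-17617 · crux · rank 2 · open · by planner
why it might fail: Gap = uniform gap of |det|-filtered Wilson QCD as β_k→∞: YM-hard, |ν_k|→∞ multiplets; the rev-7 pin bars parked witnesses, so Tail must hold at LIGHT bare masses a_k m/Z_m(k)→0 on the true critical line (quenched numerics only); an Aoki finger or first-order jump of physical width breaks the pin.
sources: Luscher1994, BoriciDeforcrand1995, OsterwalderSeilerAnnPhys1978, SeilerLNP1982, Balaban1988Convergent, EdwardsHellerNarayanan1999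
[crux] (rev 7 restatement of MultibosonLatticeGapR3 after the Statement re-type p117723 — `def
QCDOf` gained `reg.IsChiralAtZero`: R3 verbatim ∧ ONE new conjunct on reg, inserted after
HasAsymptoticScaling, CHIRALITY AT ZERO IN SUBSEQUENCE-STABLE FORM: ∀ ε > 0 ∃ m > 0 ∃ R R' (A :
QCDLatticeObservable N_f R) (B : QCDLatticeObservable N_f R') ∀ C ∀ᶠ k ∃ S ≥ L_k ∃ n ≤ S, C·exp(−ε
a_k n) < ‖qcdLatticeConnectedCorr β_k (2S+1) m(k) A B n‖ — eventually in k the ε-rate decay bound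
fails at every constant C; physically the flavour-changing pion of signed lattice QCD at
renormalised mass m(ε) ≈ ε²/(4.7 GeV) is lighter than ε on every fine lattice (GMOR m_π² ≈ 2Bm; S is
free, so no operator normalisation enters). It implies reg.IsChiralAtZero (planner Sketch.lean
`strong_imp_isChiralAtZero`, rc 0) and, unlike the plain conjunct (negated ∀ᶠ = ∃ᶠ, not preserved
along subsequences), passes to the diagonal subsequence of the continuum half (support
StableChiralityTransfers). It also RESOLVES the rev-5/6 caveat: a parked regularisation (mcrit ≡ 1)
keeps a glueball-size gap at every m and violates the clause, so the witness sits on the honest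
critical line with light bare masses a_k m/Z_m(k) → 0, w -/
@[route_item "route-QuantumFields-MultibosonBridge"]
def MultibosonLatticeGapR4 : Prop :=
  ∀ (Nf : ℕ), Nf = 2 ∨ Nf = 3 → ∃ reg : Literature.MathematicalPhysics.QuantumFieldTheory.QCDRegularisation Nf, reg.HasMassScaling ∧ (reg.scheme 0 0 0).HasAsymptoticScaling ∧ (∀ ε : ℝ, 0 < ε → ∃ m : Fin Nf → ℝ, (∀ f, 0 < m f) ∧ ∃ (R R' : ℕ) (A : Literature.MathematicalPhysics.QuantumFieldTheory.QCDLatticeObservable Nf R) (B : Literature.MathematicalPhysics.QuantumFieldTheory.QCDLatticeObservable Nf R'), ∀ C : ℝ, ∀ᶠ k in Filter.atTop, ∃ S : ℕ, (reg.scheme m 0 0).L k ≤ S ∧ ∃ n : ℕ, n ≤ S ∧ C * Real.exp (-(ε * ((reg.scheme m 0 0).a k * n))) < ‖Literature.MathematicalPhysics.QuantumFieldTheory.qcdLatticeConnectedCorr ((reg.scheme m 0 0).β k) (2 * S + 1) (fun fl => (reg.scheme m 0 0).mq fl k) A B n‖) ∧ ∀ m : Fin Nf → ℝ, (∀ f,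 0 < m f) → (∀ f, ∀ᶠ k in Filter.atTop, -1 < (reg.scheme m 0 0).mq f k) ∧ ∃ (ε δ p : ℕ → ℝ) (ℓ : ℕ → ℕ) (κ : ℕ → Fin Nf → ℝ) (ν : ℕ → Fin Nf → List ℂ), Literature.MathematicalPhysics.QuantumFieldTheory.IsAdmissibleMultibosonDataR (reg.scheme m 0 0) ε δ ℓ κ ν ∧ Filter.Tendsto (fun k => δ k / reg.a k ^ 2) Filter.atTop (nhds 0) ∧ Literature.MathematicalPhysics.QuantumFieldTheory.HasSpectralTailDomination (reg.scheme m 0 0) ε p ℓ ν ∧ ∃ Δ > 0, (reg.scheme m 0 0).HasMultibosonLatticeGap ν Δ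

/-- item stmt-QuantumFields-11439 · crux · rank 3 · open · by planner
why it might fail: Even tied (δ_k=o(a_k²)): filter range ≍ log(1/a_k)·Z_m(k)/m → ∞ in fm, so cluster expansion alone gives Δ'_k ≲ 1/range → 0 — a uniform Δ' needs a multiscale transfer; Tail is diluteness under μ^bos only; weak⇏strong mixing in d>2 (Martinelli1999 §2.3); N_f=3: sign of R.
sources: DobrushinShlosman1987, Martinelli1999, KoteckyPreiss1986, MohlerSchaefer2020, SeilerLNP1982, BenziGolub1999
[crux] (rev 6 repair of GapTransferR2, diagnosed REFUTED-MISSTATED at the physics level by the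
refuter crux-attack on stmt-11127 (notes 2026-08-15T17:09Z–17:13Z; evidence
crux_attack_GapTransferR2.md §5–6 and the drop-in signatures GapTransferR2_repaired.lean, C′/C″,
both adopted; no ¬-theorem): as typed, R2 let sch range over RAW schemes — including chiral
trajectories m_k = m_cr(β_k) + a_k²u, where signed lattice QCD has pions of vanishing physical mass
and ¬HasLatticeMassGap Δ' for every Δ' > 0 — and let δ_k → 0 at a FREE rate, although the exact
correction R = ∏_f det(H_f q_f(H_f)) = exp(Σ_f tr log(1 + r̃_f(H_f)))·(defect factors), |r̃| ≤ δ_k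
of selectable shape, is an extensive quasi-local gauge action of strength δ_k per site shifting the
bosonised theory's critical mass by ≍ δ_k/β_k² ≫ a_k²: with δ_k = 1/log k and the massive-side sign
μ^bos has physically infinitely heavy quarks — Gap plausible by the Yang–Mills bet, Tail by this
route's own dislocation-rarity bet — while QCD is chiral and gapless. REPAIR: (i) the RATE TIE
δ_k/a_k² → 0 — every induced bare-parameter shift vanishes in physical units even against a_k²u, so
μ^bos is chiral exactly when QCD is (Gap then fails: -/
@[route_item "route-QuantumFields-MultibosonBridge"]
def GapTransferR3 : Prop :=
  ∀ (Nf : ℕ) (reg : Literature.MathematicalPhysics.QuantumFieldTheory.QCDRegularisation Nf) (m : Fin Nf → ℝ) (ε δ p : ℕ → ℝ) (ℓ : ℕ → ℕ) (κ : ℕ → Fin Nf → ℝ) (ν : ℕ → Fin Nf → List ℂ) (Δ : ℝ), Nf = 2 ∨ Nf = 3 → reg.HasMassScaling → (reg.scheme 0 0 0).HasAsymptoticScaling → (∀ f, 0 < m f) → (∀ f, ∀ᶠ k in Filter.atTop, -1 < (reg.scheme m 0 0).mq f k) → Literature.MathematicalPhysics.QuantumFieldTheory.IsAdmissibleMultibosonDataR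 (reg.scheme m 0 0) ε δ ℓ κ ν → Filter.Tendsto (fun k => δ k / reg.a k ^ 2) Filter.atTop (nhds 0) → Literature.MathematicalPhysics.QuantumFieldTheory.HasSpectralTailDomination (reg.scheme m 0 0) ε p ℓ ν → 0 < Δ → (reg.scheme m 0 0).HasMultibosonLatticeGap ν Δ → ∃ Δ' : ℝ, 0 < Δ' ∧ Δ' ≤ Δ ∧ (reg.scheme m 0 0).HasLatticeMassGap Δ'

/-- item stmt-QuantumFields-17619 · crux · rank 4 · open · by planner
why it might fail: SU(3) YM lattice gap + Wilson-fermion infrared at negative bare mass, now on the HONEST critical line: false if an Aoki finger or a first-order jump of physical width crosses every light positive-mass trajectory, or if the minimal Wilson pion mass does not vanish with a (chiral clause fails).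
sources: JaffeWitten2000, OsterwalderSeilerAnnPhys1978, SeilerLNP1982, Luscher1977, MontvayMunster1994, SharpeSingleton1998
[crux] (rev 7) THE PINNED LATTICE HALF: DiagonalSpine.FullLatticeGap with the subsequence-stable
chiral clause inserted after HasAsymptoticScaling (same clause, byte-identical, as in
MultibosonLatticeGapR4, so `closes` threads it verbatim). For N_f = 2 and N_f = 3 there is one
mass-independent regularisation reg with HasMassScaling, two-loop HasAsymptoticScaling and CHIRALITY
AT ZERO — ∀ ε > 0 ∃ m > 0 ∃ observables A, B ∀ C ∀ᶠ k ∃ S ≥ L_k ∃ n ≤ S, C·exp(−ε a_k n) <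
‖qcdLatticeConnectedCorr β_k (2S+1) m(k) A B n‖ (implies reg.IsChiralAtZero and passes to
subsequences: StableChiralityTransfers) — such that for every mass tuple with all m_f > 0 the bare
masses are eventually on the physical branch (m_f(k) > −1) and signed-determinant lattice QCD has a
uniform lattice mass gap HasLatticeMassGap Δ(m), Δ(m) > 0 (all gauge-invariant local lattice
observables, all tori S ≥ L_k). In this route it is the OUTPUT of MultibosonLatticeGapR4 +
GapTransferR3 by pure logic; filed as a crux so the spine and other QCD routes can attach to the
pinned node. Why the plain conjunct is not used here: ¬HasLatticeMassGap ε negates an `∀ᶠ k` into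
`∃ᶠ k`, which a diagonal subsequence (taken by every continuum -/
@[route_item "route-QuantumFields-MultibosonBridge"]
def FullLatticeGapC : Prop :=
  ∀ Nf : ℕ, Nf = 2 ∨ Nf = 3 → ∃ reg : Literature.MathematicalPhysics.QuantumFieldTheory.QCDRegularisation Nf, reg.HasMassScaling ∧ (reg.scheme 0 0 0).HasAsymptoticScaling ∧ (∀ ε : ℝ, 0 < ε → ∃ m : Fin Nf → ℝ, (∀ f, 0 < m f) ∧ ∃ (R R' : ℕ) (A : Literature.MathematicalPhysics.QuantumFieldTheory.QCDLatticeObservable Nf R) (B : Literature.MathematicalPhysics.QuantumFieldTheory.QCDLatticeObservable Nf R'), ∀ C : ℝ, ∀ᶠ k in Filter.atTop, ∃ S : ℕ, (reg.scheme m 0 0).L k ≤ S ∧ ∃ n : ℕ, n ≤ S ∧ C * Real.exp (-(ε * ((reg.scheme m 0 0).a k * n))) < ‖Literature.MathematicalPhysics.QuantumFieldTheory.qcdLatticeConnectedCorr ((reg.scheme m 0 0).β k) (2 * S + 1) (fun fl => (reg.scheme m 0 0).mq fl k) A B n‖) ∧ ∀ m : Fin Nf → ℝ, (∀ f, 0 <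 m f) → (∀ f, ∀ᶠ k in Filter.atTop, -1 < (reg.scheme m 0 0).mq f k) ∧ ∃ Δ > 0, (reg.scheme m 0 0).HasLatticeMassGap Δ

/-- item stmt-QuantumFields-17620 · crux · rank 5 · open · by planner
why it might fail: Given the pinned lattice gap still: E1 (rotations) of a subsequential 4D lattice limit has no non-perturbative proof; calibrated tightness = fermionic UV stability, unproved; gap constants carry no m-uniformity (equicontinuity at contact terms); only the chiral clause transfers for free.
sources: OsterwalderSchraderCMP1975, OsterwalderSeilerAnnPhys1978, SeilerLNP1982, GlimmJaffeQP1987, Balaban1988Convergent, BalabanOcarrollSchor1989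
[crux] (rev 7) THE CONTINUUM HALF over the pinned lattice half: FullLatticeGapC → QCD
(DiagonalSpine.LatticeToContinuum with the pinned antecedent; the unpinned node FullLatticeGap → QCD
would, after the re-type, ask its prover to produce reg.IsChiralAtZero from a possibly parked
regularisation and is dropped from this route). Proof shape (cards arzela-ascoli-in-the-quark-mass,
quarks-add-no-infrared-clause): from the gapped, chirally pinned reg pass to ONE diagonal
subsequence φ serving all masses (countable index: n × species strings × dense test functions;
masses in compacts of (0,∞)^{N_f}); every clause of reg is a tail property and survives, INCLUDING
the chiral clause (StableChiralityTransfers, which also delivers the Statement's conjunct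
(reg∘φ).IsChiralAtZero); calibrate species renormalisations z(m,k), shift(m,k); convergence from
calibrated tightness + mass-equicontinuity from the gap; the limits are OS data (E0', E2–E4 closed
under limits; E1 rotations RESTORED); IsQCDAlong; T.HasMassGap Δ(m) from uniform clustering;
IsNontrivial glue, IsNonGaussian glue, IsNontrivial (pseudoRe f g) from lattice lower bounds (RP
window). This route adds to the spine's proof only that, th -/
@[route_item "route-QuantumFields-MultibosonBridge"]
def LatticeToContinuumC : Prop :=
  FullLatticeGapC → QCD

/-- item stmt-QuantumFields-10699 · support · rank 9 · closed · proved by Summit.QuantumFields.QCD.Theorems.MultibosonBridge.admissibleRootsExistR_proof (prover) · by planner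
sources: Luscher1994, FrezzottiJansen1997, BorrelliDeforcrandGalli1996, BenziGolub1999
[support] (repaired AdmissibleRootsExist, rev 4.) Two-interval approximation with a gap, in the
normalised form the cruxes use: for 0 < ε < 1, 0 < δ < 1, c > 0 and ℓ ∈ ℕ with ε ℓ² ≥ 64 there are κ
> 0 and a list of ≤ ℓ·log(2/δ) NON-REAL roots with |t|·κ∏|t − z|² ∈ [1−δ, 1+δ] for √ε c ≤ |t| ≤ c
and ≤ 1+δ for |t| ≤ √ε c. What changed: (i) the normalisation κ (Lüscher's c_n; the refuted text
forced a monic polynomial below 2 on [−c,c], c ≥ 4 — impossible), so c > 0 is free by scaling; (ii)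
the ε-uniform Chebyshev-mass certificate (refuted: every admissible polynomial has Σ|b_j| ≥
((1−δ)/π)log(1/ε) − O(1)) is replaced by the degree bound |l| ≤ ℓ log(2/δ), the locality the
transfer uses (strict finite range). Construction (numerics in the planner folder,
checks/construction_M.py): x = t/c, s = x², g(s) = (s + δε)^(−1/2) = ∫dμ(u)/(s+u) is a Stieltjes
function, dμ = (1/π)(u − δε)^(−1/2)du on u > δε; let P interpolate g at the m+1 Chebyshev nodes s_i
of [ε,1], m EVEN, m+1 ≥ log(4/δ)/(2√ε) (so m ≤ log(2/δ)/√ε + 2 ≤ 8 log(2/δ)/√ε ≤ ℓ log(2/δ)).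
Explicitly P(s) = ∫dμ(u)(1 − ω(s)/ω(−u))/(s+u), ω = ∏(s − s_i), so g − P = ω(s)∫dμ(u)/(ω(−u)(s+u)):
relative error on [ε,1] ≤ |ω(s)|/|ω(0)| ≤ 1/T_(m+ -/
@[route_item "route-QuantumFields-MultibosonBridge"]
def AdmissibleRootsExistR : Prop :=
  ∀ (ε δ c : ℝ) (ℓ : ℕ), 0 < ε → ε < 1 → 0 < δ → δ < 1 → 0 < c → 64 ≤ ε * (ℓ : ℝ) ^ 2 → ∃ (κ : ℝ) (l : List ℂ), 0 < κ ∧ (l.length : ℝ) ≤ (ℓ : ℝ) * Real.log (2 / δ) ∧ (∀ z ∈ l, z.im ≠ 0) ∧ (∀ t : ℝ, Real.sqrt ε * c ≤ |t| → |t| ≤ c → |t| * (κ * (l.map fun z => ‖(t : ℂ) - z‖ ^ 2).prod) - 1 ≤ δ ∧ 1 - |t| * (κ * (l.map fun z => ‖(t : ℂ) - z‖ ^ 2).prod) ≤ δ) ∧ (∀ t : ℝ, |t| ≤ Real.sqrt ε * c → |t| * (κ * (l.map fun z => ‖(t : ℂ) - z‖ ^ 2).prod) ≤ 1 + δ)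

-- `AdmissibleRootsExistR` holds: proved by `Summit.QuantumFields.QCD.Theorems.MultibosonBridge.admissibleRootsExistR_proof` (its module imports this route file, so no `_holds` link can be stated here).

/-- item stmt-QuantumFields-17621 · support · rank 9 · closed · proved by Summit.QuantumFields.QCD.Theorems.multibosonBridge_stableChiralityTransfers_proof (prover) · by planner
sources: MontvayMunster1994, OsterwalderSeilerAnnPhys1978
[support] (rev 7) SUBSEQUENCE STABILITY OF THE CHIRAL CLAUSE + THE STATEMENT'S CONJUNCT: for reg,
reg' : QCDRegularisation N_f and a strictly increasing φ : ℕ → ℕ with reg'.a = reg.a ∘ φ, reg'.β =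
reg.β ∘ φ, reg'.L = reg.L ∘ φ, reg'.mcrit = reg.mcrit ∘ φ, reg'.Zm = reg.Zm ∘ φ, the
subsequence-stable chiral clause of reg (∀ ε > 0 ∃ m > 0 ∃ A B ∀ C ∀ᶠ k ∃ S ≥ L_k ∃ n ≤ S, C·exp(−ε
a_k n) < ‖qcdLatticeConnectedCorr β_k (2S+1) m(k) A B n‖) implies the same clause for reg' AND
reg'.IsChiralAtZero (take φ = id, reg' = reg for 'Strong ⟹ the Statement's conjunct'). Companion of
DiagonalSpine.SubsequenceStability for the clause added in rev 7; used inside LatticeToContinuumC.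
Proof (done in the planner's Sketch.lean rev 7, rc 0, std axioms — attached as evidence):
`StrictMono.tendsto_atTop` + `Tendsto.eventually` move `∀ᶠ k` along φ; the fields rewrite by
`QCDRegularisation.scheme_mq` and the five equalities; for IsChiralAtZero, given HasLatticeMassGap ε
with constant C, `(h C).and hC` is an eventually-true conjunction on atTop, `.exists` gives k with
both the bound and its strict violation. -/
@[route_item "route-QuantumFields-MultibosonBridge"]
def StableChiralityTransfers : Prop :=
  ∀ (Nf : ℕ) (reg reg' : Literature.MathematicalPhysics.QuantumFieldTheory.QCDRegularisation Nf) (φ : ℕ → ℕ), StrictMono φ → reg'.a = reg.a ∘ φ → reg'.β = reg.β ∘ φ → reg'.L = reg.L ∘ φ → reg'.mcrit = reg.mcrit ∘ φ → reg'.Zm = reg.Zm ∘ φ → (∀ ε : ℝ, 0 < ε → ∃ m : Fin Nf → ℝ, (∀ f, 0 < m f) ∧ ∃ (R R' : ℕ) (A : Literature.MathematicalPhysics.QuantumFieldTheory.QCDLatticeObservable Nf R) (B : Literature.MathematicalPhysics.QuantumFieldTheory.QCDLatticeObservable Nf R'), ∀ C : ℝ, ∀ᶠ k in Filter.atTop,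 ∃ S : ℕ, (reg.scheme m 0 0).L k ≤ S ∧ ∃ n : ℕ, n ≤ S ∧ C * Real.exp (-(ε * ((reg.scheme m 0 0).a k * n))) < ‖Literature.MathematicalPhysics.QuantumFieldTheory.qcdLatticeConnectedCorr ((reg.scheme m 0 0).β k) (2 * S + 1) (fun fl => (reg.scheme m 0 0).mq fl k) A B n‖) → (∀ ε : ℝ, 0 < ε → ∃ m : Fin Nf → ℝ, (∀ f, 0 < m f) ∧ ∃ (R R' : ℕ) (A : Literature.MathematicalPhysics.QuantumFieldTheory.QCDLatticeObservable Nf R) (B : Literature.MathematicalPhysics.QuantumFieldTheory.QCDLatticeObservable Nf R'), ∀ C : ℝ, ∀ᶠ k in Filter.atTop, ∃ S : ℕ, (reg'.scheme m 0 0).L k ≤ S ∧ ∃ n : ℕ, n ≤ S ∧ C * Real.exp (-(ε * ((reg'.scheme m 0 0).a k * n))) < ‖Literature.MathematicalPhysics.QuantumFieldTheory.qcdLatticeConnectedCorr ((reg'.scheme m 0 0).β k) (2 * S + 1) (fun fl => (reg'.scheme m 0 0).mq fl k) A B n‖) ∧ reg'.IsChiralAtZero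

-- `StableChiralityTransfers` holds: proved by `Summit.QuantumFields.QCD.Theorems.multibosonBridge_stableChiralityTransfers_proof` (its module imports this route file, so no `_holds` link can be stated here).

/-- item stmt-QuantumFields-9601 · support · rank 9 · closed · proved by Summit.QuantumFields.QCD.Theorems.MultibosonBridge.reweightingIdentity_proof (prover) · by planner
sources: Luscher1994, MontvayMunster1994
[support] the exact bridge: for non-real root lists every lattice QCD torus expectation
`qcdTorusExpect β S m X` equals E^bos[FI(X·e^(−ψ̄Dψ))/W] / E^bos[FI(e^(−ψ̄Dψ))/W], E^bos the
bosonised expectation with weight W = ∏_f ∏_z |det(γ₅D_W(m_f) − z)|⁻² (W > 0 pointwise and bounded;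
constants cancel; no integrability subtleties since the identity is pointwise). [difficulty:
provable-now] -/
@[route_item "route-QuantumFields-MultibosonBridge"]
def ReweightingIdentity : Prop :=
  ∀ (Nf S : ℕ) [NeZero S] (β : ℝ) (mq : Fin Nf → ℝ) (l : Fin Nf → List ℂ) (X : Literature.MathematicalPhysics.QuantumFieldTheory.GaugeConfig 4 S (Matrix.specialUnitaryGroup (Fin 3) ℂ) → Literature.MathematicalPhysics.QuantumFieldTheory.FermiAlg Nf S), (∀ f, ∀ z ∈ l f, z.im ≠ 0) → let Dm := fun (S : ℕ) [NeZero S] (U : Literature.MathematicalPhysics.QuantumFieldTheory.GaugeConfig 4 S (Matrix.specialUnitaryGroup (Fin 3) ℂ)) (μ : ℝ) => Literature.MathematicalPhysics.QuantumLattice.wilsonDirac (Literature.MathematicalPhysics.QuantumLattice.fundamentalRep (Fin 3)) U μ 1; let W := fun (S : ℕ) [NeZero S] (mq : Fin Nf → ℝ) (l : Fin Nf → List ℂ) U => (∏ f, ((l f).map fun z => ‖(Literature.MathematicalPhysics.QuantumLattice.spinorLift Literature.MathematicalPhysics.QuantumLattice.gammaFive * Dm S U (mq f) - z • 1).det‖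 ^ 2).prod)⁻¹; let E := fun (S : ℕ) [NeZero S] (β : ℝ) (mq : Fin Nf → ℝ) (l : Fin Nf → List ℂ) (g : _ → ℂ) => let μW := Literature.MathematicalPhysics.QuantumFieldTheory.wilsonMeasure (d := 4) (L := S) (Literature.MathematicalPhysics.QuantumLattice.fundamentalRep (Fin 3)) β; MeasureTheory.integral μW (fun U => (W S mq l U : ℂ) * g U) / MeasureTheory.integral μW (fun U => (W S mq l U : ℂ)); Literature.MathematicalPhysics.QuantumFieldTheory.qcdTorusExpect β S mq X = E S β mq l (fun U => Literature.MathematicalPhysics.QuantumFieldTheory.fermiIntegral (X U * Literature.MathematicalPhysics.QuantumFieldTheory.fermiBoltzmann U mq) / W S mq l U) / E S β mq l (fun U => Literature.MathematicalPhysics.QuantumFieldTheory.fermiIntegral (Literature.MathematicalPhysics.QuantumFieldTheory.fermiBoltzmann U mq) / W S mq l U)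

-- `ReweightingIdentity` holds: proved by `Summit.QuantumFields.QCD.Theorems.MultibosonBridge.reweightingIdentity_proof` (its module imports this route file, so no `_holds` link can be stated here).

/-- item stmt-QuantumFields-9602 · support · rank 9 · closed · proved by Summit.QuantumFields.QCD.Theorems.MultibosonBridge.multibosonGaussian_proof (prover) · by planner
sources: Luscher1994, GlimmJaffe1987
[support] the dictionary "one root = one local boson field": for non-real z, ∫_(ℂ^N)
exp(−‖(γ₅D_W(U,μ) − z)v‖²) dv = π^N / |det(γ₅D_W(U,μ) − z)|², so each factor of W is a convergent
Gaussian integral with positive, gauge-covariant, next-nearest-neighbour quadratic action and the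
bosonised theory IS a lattice SU(3) gauge–Higgs system. [difficulty: provable-now] -/
@[route_item "route-QuantumFields-MultibosonBridge"]
def MultibosonGaussian : Prop :=
  ∀ (S : ℕ) [NeZero S] (U : Literature.MathematicalPhysics.QuantumFieldTheory.GaugeConfig 4 S (Matrix.specialUnitaryGroup (Fin 3) ℂ)) (μ : ℝ) (z : ℂ), z.im ≠ 0 → MeasureTheory.integral MeasureTheory.volume (fun v : (Literature.Probability.LatticeModels.TorusSite 4 S × Fin 3 × Fin 4) → ℂ => Real.exp (-(∑ i, ‖((Literature.MathematicalPhysics.QuantumLattice.spinorLift Literature.MathematicalPhysics.QuantumLattice.gammaFive * Literature.MathematicalPhysics.QuantumLattice.wilsonDirac (Literature.MathematicalPhysics.QuantumLattice.fundamentalRep (Fin 3)) U μ 1 - z • 1).mulVec v) i‖ ^ 2))) = Real.pi ^ Fintype.card (Literature.Probability.LatticeModels.TorusSite 4 S × Fin 3 × Fin 4) / ‖(Literature.MathematicalPhysics.QuantumLattice.spinorLift Literature.MathematicalPhysics.QuantumLattice.gammaFive * Literature.MathematicalPhysics.QuantumLattice.wilsonDirac (Literature.MathematicalPhysics.QuantumLattice.fundamentalRep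 (Fin 3)) U μ 1 - z • 1).det‖ ^ 2

-- `MultibosonGaussian` holds: proved by `Summit.QuantumFields.QCD.Theorems.MultibosonBridge.multibosonGaussian_proof` (its module imports this route file, so no `_holds` link can be stated here).

-- item stmt-QuantumFields-9787 · support · rank 9 · open · by planner — informal only, no Lean statement yet:
--   [support] LimitTransfer (own-volume transfer of CONVERGENCE; typed in the planner's gen3.py/Sketch
--   at 4.3k chars, over the gate's 4000-char cap — signature to be set once defn-multibosonExpect /
--   defn-IsAdmissibleMultibosonData land): for EVERY sch : QCDScheme N_f, data (ε δ : ℕ → ℝ) (ν : ℕ →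
--   Fin N_f → List ℂ) and T : OSData (QCDField N_f) 4: AdmLite (accuracy |t|q = 1 ± δ_k off the gap,
--   |t|q ≤ 1+δ_k on it, non-real roots, δ_k below every power of κ_k := a_k
--   ε_k/((L_k+1)(1+Σ_s|z_s(k)|))) → TailOwn (the bosonised probability, at the scheme's OWN volume
--   2L_k+1, of a global spectral defect — a qua

-- earlier Assembly (stmt-QuantumFields-10700, replaced 2026-08-15T16:49:54Z -> stmt-QuantumFields-11128): retired by None — MultibosonLatticeGapR → GapTransferR → LatticeToContinuum → QCD
-- earlier Assembly (stmt-QuantumFields-11128, replaced 2026-08-15T17:50:37Z -> stmt-QuantumFields-11440): retired by None — MultibosonLatticeGapR2 → GapTransferR2 → LatticeToContinuum → QCD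
-- earlier Assembly (stmt-QuantumFields-11440, replaced 2026-08-16T23:23:54Z -> stmt-QuantumFields-17618): retired by None — MultibosonLatticeGapR3 → GapTransferR3 → LatticeToContinuum → QCD
-- earlier Assembly (stmt-QuantumFields-9604, replaced 2026-08-15T16:21:23Z -> stmt-QuantumFields-10700): retired by None — MultibosonLatticeGap → GapTransfer → LatticeToContinuum → QCD
/-- item stmt-QuantumFields-17618 · assembly · rank 1 · closed · proved by Summit.QuantumFields.QCD.Theorems.multibosonBridge_assembly_proof (prover) · by planner
sources: JaffeWitten2000, Luscher1994
[assembly] MultibosonLatticeGapR4 → GapTransferR3 → LatticeToContinuumC → QCD (rev 7: R4 = R3 + the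
subsequence-stable chiral pin replaces R3 — retired, not refuted — after the Statement re-type
p117723; the pinned pair FullLatticeGapC / LatticeToContinuumC replaces the spine nodes in this
route; `closes` proves exactly this by pure logic, planner Sketch.lean rc 0). -/
@[route_item "route-QuantumFields-MultibosonBridge"]
def Assembly : Prop :=
  MultibosonLatticeGapR4 → GapTransferR3 → LatticeToContinuumC → QCD

-- `Assembly` holds: proved by `Summit.QuantumFields.QCD.Theorems.multibosonBridge_assembly_proof` (its module imports this route file, so no `_holds` link can be stated here).

-- records of items no longer active in this route (dropped / restated):
-- earlier MultibosonLatticeGapR (stmt-QuantumFields-10697, replaced 2026-08-15T16:49:54Z -> stmt-QuantumFields-11126): retired by None — ∀ (Nf : ℕ), Nf = 2 ∨ Nf = 3 → ∃ reg : Literature.MathematicalPhysics.QuantumFieldTheory.QCDRegularisation Nf, reg.HasMassScaling ∧ (reg.scheme 0 0 0).HasAsymptoticScaling ∧ ∀ m : Fin Nf → ℝ, (∀ f, 0 < m f) → (∀ f, ∀ᶠ k in Filter.atTop, -1 < (reg.scheme m 0 0).mq f 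
-- earlier GapTransferR (stmt-QuantumFields-10698, replaced 2026-08-15T16:49:54Z -> stmt-QuantumFields-11127): retired by None — ∀ (Nf : ℕ) (sch : Literature.MathematicalPhysics.QuantumFieldTheory.QCDScheme Nf) (ε δ p : ℕ → ℝ) (ℓ : ℕ → ℕ) (κ : ℕ → Fin Nf → ℝ) (ν : ℕ → Fin Nf → List ℂ) (Δ : ℝ), let Dm := fun (S : ℕ) [NeZero S] (U : Literature.MathematicalPhysics.QuantumFieldTheory.GaugeConfig 4 S (Mat
-- earlier MultibosonLatticeGapR2 (stmt-QuantumFields-11126, replaced 2026-08-15T17:50:37Z -> stmt-QuantumFields-11438): retired by None — ∀ (Nf : ℕ), Nf = 2 ∨ Nf = 3 → ∃ reg : Literature.MathematicalPhysics.QuantumFieldTheory.QCDRegularisation Nf, reg.HasMassScaling ∧ (reg.scheme 0 0 0).HasAsymptoticScaling ∧ ∀ m : Fin Nf → ℝ, (∀ f, 0 < m f) → (∀ f, ∀ᶠ k in Filter.atTop, -1 < (reg.scheme m 0 0).mq f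
-- earlier GapTransferR2 (stmt-QuantumFields-11127, replaced 2026-08-15T17:50:37Z -> stmt-QuantumFields-11439): retired by None — ∀ (Nf : ℕ) (sch : Literature.MathematicalPhysics.QuantumFieldTheory.QCDScheme Nf) (ε δ p : ℕ → ℝ) (ℓ : ℕ → ℕ) (κ : ℕ → Fin Nf → ℝ) (ν : ℕ → Fin Nf → List ℂ) (Δ : ℝ), let Dm := fun (S : ℕ) [NeZero S] (U : Literature.MathematicalPhysics.QuantumFieldTheory.GaugeConfig 4 S (Ma
-- earlier MultibosonLatticeGapR3 (stmt-QuantumFields-11438, replaced 2026-08-16T23:23:54Z -> stmt-QuantumFields-17617): retired by None — ∀ (Nf : ℕ), Nf = 2 ∨ Nf = 3 → ∃ reg : Literature.MathematicalPhysics.QuantumFieldTheory.QCDRegularisation Nf, reg.HasMassScaling ∧ (reg.scheme 0 0 0).HasAsymptoticScaling ∧ ∀ m : Fin Nf → ℝ, (∀ f, 0 < m f) → (∀ f, ∀ᶠ k in Filter.atTop, -1 < (reg.scheme m 0 0).mq f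
-- earlier MultibosonLatticeGap (stmt-QuantumFields-9599, replaced 2026-08-15T16:21:23Z -> stmt-QuantumFields-10697): refuted by Summit.QuantumFields.QCD.Theorems.MultibosonBridgeMultibosonLatticeGap_refuted @ bf1b9feced0d — ∀ (Nf : ℕ), Nf = 2 ∨ Nf = 3 → ∃ reg : Literature.MathematicalPhysics.QuantumFieldTheory.QCDRegularisation Nf, reg.HasMassScaling ∧ (reg.scheme 0 0 0).HasAsymptoticScaling ∧ ∀ m :
-- earlier GapTransfer (stmt-QuantumFields-9600, replaced 2026-08-15T16:21:23Z -> stmt-QuantumFields-10698): retired by None — ∀ (Nf : ℕ) (sch : Literature.MathematicalPhysics.QuantumFieldTheory.QCDScheme Nf) (ε δ p : ℕ → ℝ) (ℓ : ℕ → ℕ) (ν : ℕ → Fin Nf → List ℂ) (Δ : ℝ), let Dm := fun (S : ℕ) [NeZero S] (U : Literature.MathematicalPhysics.QuantumFieldTheory.GaugeConfig 4 S (Matrix.specialUnitaryGroup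
-- earlier AdmissibleRootsExist (stmt-QuantumFields-9603, replaced 2026-08-15T16:21:23Z -> stmt-QuantumFields-10699): refuted by Summit.QuantumFields.QCD.Theorems.MultibosonBridgeAdmissibleRootsExist_refuted @ db990acf8fa4 — ∃ C : ℝ, 0 < C ∧ ∀ (ε δ c : ℝ) (ℓ : ℕ), 0 < ε → ε < 1 → 0 < δ → δ < 1 → 4 ≤ c → C * Real.log (2 / δ) ^ 2 / Real.sqrt ε ≤ ℓ → ∃ l : List ℂ, (l.length : ℝ) ≤ C * Real.log (2 / δ) ^

/-! D-0027 §2.1 — DECIDING THEOREM (planner-authored via `route open/edit --closes-file`; by planner-rrepair-QuantumFields-MultibosonBridge-04420b5f-0 2026-08-16T23:23:54Z):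
its hypotheses are this route's items and its conclusion the sub-problem Statement (glue_lint), and it elaborates with this file. -/

@[closes "route-QuantumFields-MultibosonBridge"] theorem closes : MultibosonLatticeGapR4 → GapTransferR3 → LatticeToContinuumC → QCD := by
  intro hM hG hL
  apply hL
  intro Nf hNf
  obtain ⟨reg, hms, has, hchi, hall⟩ := hM Nf hNf
  refine ⟨reg, hms, has, hchi, fun m hm => ?_⟩
  obtain ⟨hbr, ε, δ, p, ℓ, κ, ν, hAdm, hRate, hTail, Δ, hΔ, hGap⟩ := hall m hm
  obtain ⟨Δ', h1, -, h3⟩ := hG Nf reg m ε δ p ℓ κ ν Δ hNf hms has hm hbr hAdm hRate hTail hΔ hGap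
  exact ⟨hbr, Δ', h1, h3⟩

end Summit.QuantumFields.QCD.Theses.MultibosonBridge
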